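import Literature.NumberTheory.Automorphic.AsaiSign
import Mathlib.Analysis.SpecialFunctions.Complex.LogBounds
import HarnessLib

/-!
# Raw poles of partial Asai Euler products: from unconditional to absolute convergence

Topic `NumberTheory/Automorphic`; namespace `Literature.NumberTheory.Automorphic`. Proof file
(theorems only: no definition, no named fact, no instance), sibling of `AsaiSign`
(provefact unit `Mok2014_archimedean_parity_of_asaiSign`, 2026-08-16).

## Content

* `HasProd.summable_norm_sub_one` (**folklore, the converse of Mathlib's
  `multipliable_one_add_of_summable` in `ℂ`**): an unconditionally convergent product in `ℂ` with a
  *non-zero* value is absolutely convergent, `∑ ‖f i - 1‖ < ∞` (the Cauchy net of finite partial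
  products puts every finite sub-product away from a finite set within `ε` of `1`; principal
  logarithms then have uniformly bounded finite sub-sums, hence are absolutely summable).
* Consequences for the raw-limit currency `AutomorphicRepData.HasAsaiPole` of `AsaiSign.lean`: a
  raw pole `(s - 1) · L^S(s, A, As^η) → r ≠ 0` (`s → 1`, `Re s > 1`) of the unconditional `tprod`
  `partialAsaiL S c A η` forces, for all `s` near `1` with `Re s > 1`, the partial Euler product to
  be multipliable with a value `≠ 0, 1`, every local factor `P_v(s) = (asaiLocalPolynomial …)(q_v^{-s})`
  to be non-zero, and `∑_v ‖P_v(s) - 1‖ < ∞`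
  (`eventually_summable_norm_sub_one_of_tendsto_partialAsaiL`).
* **The raw-to-continued bridge** `false_of_tendsto_partialAsaiL_of_holomorphic_continuation`
  (appended 2026-08-16, same unit): a raw pole of `partialAsaiL S c A η` at `s = 1` is incompatible
  with ANY holomorphic continuation of it from a right half-plane to `{1/2 < Re s}` — for an
  arbitrary Satake family, with no convergence hypothesis on `1 < Re s ≤ C`. Ingredients, all
  proved here: Baire's theorem (`exists_ball_forall_sum_le_of_summable`), Cauchy's formula as a
  mean-value estimate (`norm_le_mean_circle_of_differentiable`), averaging along a fast phase
  (`mul_mean_le_integral_comp_of_periodic`), the passage from a locally uniform bound on a ball to a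
  summable bound on a half-plane (`exists_summable_norm_sub_one_le_of_forall_sum_le`), a generic
  Weierstrass `M`-test (`differentiableOn_tprod_inv_of_norm_sub_one_le`) and the identity theorem.
  Corollary `AutomorphicRepData.HasAsaiPole.false_of_continuation`: the accepted
  `HasAsaiPole.false_of_holomorphic_continuation` (`MokStandardBaseChangeDescentContinuation.lean`)
  without its holomorphy hypothesis `hhol`. Hence a raw Asai pole in HYPOTHESIS position (as in
  `Mok2014_standardBaseChange_descent` and `Mok2014_archimedean_parity_of_asaiSign`) is weaker than
  the printed pole of the continued Asai `L`-function, given Mok's dichotomy in continuation form.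
* The positive form (appended): `exists_summable_norm_sub_one_le_of_tendsto_partialAsaiL`,
  `summable_norm_sub_one_of_tendsto_partialAsaiL`, `AutomorphicRepData.HasAsaiPole.summable_norm_sub_one`
  — a raw pole at `1` forces normal convergence of `∑_v (P_v(s) - 1)` on every closed half-plane
  `{σ₁ ≤ Re s}`, `σ₁ > 1`, hence absolute convergence at every point of `{1 < Re s}`; and the
  reduction `Mok2014_archimedean_parity_of_asaiSign_of_continuation` of the archimedean parity fact
  to its printed-currency form plus the corrected dichotomy.

## References

* K. Knopp, *Theory and Application of Infinite Series* (1951), Ch. VII §29 (absolute convergence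
  of products versus series). [folklore]
* C. P. Mok, *Endoscopic classification of representations of quasi-split unitary groups*,
  Mem. Amer. Math. Soc. 235 (2015), no. 1108, §2.5. [Mok2014]
-/

noncomputable section

open scoped Topology
open Filter Complex

namespace Literature.NumberTheory.Automorphic

/-! ### Unconditionally convergent products with non-zero value are absolutely convergent -/

section ProductToSum

variable {ι : Type*} {f : ι → ℂ} {a : ℂ}

/-- A factor of an unconditionally convergent product with non-zero value is non-zero (otherwise
all large partial products vanish). [folklore] -/
theorem _root_.HasProd.ne_zero_apply (hf : HasProd f a) (ha : a ≠ 0) (i : ι) : f i ≠ 0 := by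
  intro hi
  apply ha
  have h0 : Tendsto (fun s : Finset ι => ∏ b ∈ s, f b) atTop (𝓝 (0 : ℂ)) := by
    refine tendsto_const_nhds.congr' ?_
    rw [EventuallyEq, eventually_atTop]
    exact ⟨{i}, fun s hs => (Finset.prod_eq_zero (hs (Finset.mem_singleton_self i)) hi).symm⟩
  have hf' : Tendsto (fun s : Finset ι => ∏ b ∈ s, f b) atTop (𝓝 a) := by
    simpa [HasProd] using hf
  exact tendsto_nhds_unique hf' h0

/-- **Cauchy property of an unconditional product with non-zero value, multiplicative form**: for
every `ε > 0` there is a finite set `S₀` such that every finite product of factors outside `S₀` is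
within `ε` of `1`. [folklore] -/
theorem _root_.HasProd.exists_finset_norm_prod_sub_one_le (hf : HasProd f a) (ha : a ≠ 0)
    {ε : ℝ} (hε : 0 < ε) :
    ∃ S₀ : Finset ι, ∀ T : Finset ι, Disjoint T S₀ → ‖∏ i ∈ T, f i - 1‖ ≤ ε := by
  classical
  have ha0 : 0 < ‖a‖ := norm_pos_iff.mpr ha
  set ε' : ℝ := min (‖a‖ / 2) (ε * ‖a‖ / 4) with hε'
  have hε'0 : 0 < ε' := lt_min (by positivity) (by positivity)
  have hf' : Tendsto (fun s : Finset ι => ∏ b ∈ s, f b) atTop (𝓝 a) := by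
    simpa [HasProd] using hf
  obtain ⟨S₀, hS₀⟩ := eventually_atTop.mp (hf' (Metric.ball_mem_nhds a hε'0))
  refine ⟨S₀, fun T hT => ?_⟩
  have hP : dist (∏ b ∈ S₀, f b) a < ε' := hS₀ S₀ le_rfl
  have hQ : dist (∏ b ∈ S₀ ∪ T, f b) a < ε' := hS₀ (S₀ ∪ T) Finset.subset_union_left
  rw [Finset.prod_union (Finset.disjoint_left.mpr fun i hi hiT =>
    Finset.disjoint_left.mp hT hiT hi)] at hQ
  set P := ∏ b ∈ S₀, f b with hPdef
  set Q := ∏ b ∈ T, f b with hQdef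
  rw [dist_eq_norm] at hP hQ
  have hε'1 : ε' ≤ ‖a‖ / 2 := min_le_left _ _
  have hε'2 : ε' ≤ ε * ‖a‖ / 4 := min_le_right _ _
  -- `‖P‖ ≥ ‖a‖ / 2`
  have hPnorm : ‖a‖ / 2 ≤ ‖P‖ := by
    have : ‖a‖ ≤ ‖P‖ + ‖P - a‖ := by
      calc ‖a‖ = ‖P - (P - a)‖ := by rw [sub_sub_cancel]
        _ ≤ ‖P‖ + ‖P - a‖ := norm_sub_le _ _
    linarith
  have hP0 : P ≠ 0 := by
    intro h; rw [h, norm_zero] at hPnorm; linarith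
  -- `Q - 1 = (P Q - P) / P`
  have hQP : Q - 1 = (P * Q - P) / P := by field_simp
  have hnum : ‖P * Q - P‖ ≤ 2 * ε' := by
    calc ‖P * Q - P‖ = ‖(P * Q - a) - (P - a)‖ := by ring_nf
      _ ≤ ‖P * Q - a‖ + ‖P - a‖ := norm_sub_le _ _
      _ ≤ ε' + ε' := add_le_add hQ.le hP.le
      _ = 2 * ε' := by ring
  rw [hQP, norm_div]
  rw [div_le_iff₀ (norm_pos_iff.mpr hP0)]
  calc ‖P * Q - P‖ ≤ 2 * ε' := hnum
    _ ≤ 2 * (ε * ‖a‖ / 4) := by linarith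
    _ = ε * (‖a‖ / 2) := by ring
    _ ≤ ε * ‖P‖ := mul_le_mul_of_nonneg_left hPnorm hε.le

/-- The principal logarithm is additive over a finite product all of whose sub-products stay within
`1/2` of `1`: `∑_{i ∈ T} log (f i) = log (∏_{i ∈ T} f i)` (no `2πi` ambiguity, the arguments staying
in `(-π, π]`). [folklore] -/
theorem sum_log_eq_log_prod_of_forall_norm_prod_sub_one_le {S₀ : Finset ι}
    (h : ∀ T : Finset ι, Disjoint T S₀ → ‖∏ i ∈ T, f i - 1‖ ≤ 1 / 2) :
    ∀ T : Finset ι, Disjoint T S₀ → ∑ i ∈ T, log (f i) = log (∏ i ∈ T, f i) := by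
  classical
  -- a sub-product within `1/2` of `1` is non-zero and has a small logarithm
  have hlog : ∀ T : Finset ι, Disjoint T S₀ → ‖log (∏ i ∈ T, f i)‖ ≤ 3 / 4 := by
    intro T hT
    have h1 := h T hT
    have := norm_log_one_add_half_le_self h1
    rw [add_sub_cancel] at this
    linarith
  have hne : ∀ T : Finset ι, Disjoint T S₀ → ∏ i ∈ T, f i ≠ 0 := by
    intro T hT h0
    have h1 := h T hT
    rw [h0, zero_sub, norm_neg, norm_one] at h1
    norm_num at h1
  intro T
  induction T using Finset.induction_on with
  | empty => intro; simp
  | insert j T hj ih =>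
    intro hT
    have hT' : Disjoint T S₀ := Finset.disjoint_of_subset_left (Finset.subset_insert j T) hT
    have hjT : Disjoint ({j} : Finset ι) S₀ :=
      Finset.disjoint_of_subset_left (Finset.singleton_subset_iff.mpr
        (Finset.mem_insert_self j T)) hT
    rw [Finset.sum_insert hj, Finset.prod_insert hj, ih hT']
    set x := log (f j) with hx
    set y := log (∏ i ∈ T, f i) with hy
    have hxn : ‖x‖ ≤ 3 / 4 := by simpa using hlog {j} hjT
    have hyn : ‖y‖ ≤ 3 / 4 := hlog T hT'
    have hfj : f j ≠ 0 := by simpa using hne {j} hjT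
    have hfT : ∏ i ∈ T, f i ≠ 0 := hne T hT'
    have hexp : exp (x + y) = f j * ∏ i ∈ T, f i := by
      rw [exp_add, hx, hy, exp_log hfj, exp_log hfT]
    have him : |(x + y).im| < Real.pi := by
      have h1 : |x.im| ≤ ‖x‖ := abs_im_le_norm x
      have h2 : |y.im| ≤ ‖y‖ := abs_im_le_norm y
      have h3 : |(x + y).im| ≤ |x.im| + |y.im| := by rw [add_im]; exact abs_add_le _ _
      have hpi : (3 : ℝ) < Real.pi := Real.pi_gt_three
      linarith
    rw [← hexp, log_exp (by linarith [neg_abs_le (x + y).im, (abs_lt.mp him).1])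
      (abs_lt.mp him).2.le]

/-- **An unconditionally convergent product in `ℂ` with non-zero value is absolutely convergent**:
`HasProd f a`, `a ≠ 0` imply `∑ ‖f i - 1‖ < ∞` — the converse (in `ℂ`) of Mathlib's
`multipliable_one_add_of_summable`. Proof: by the Cauchy property
(`HasProd.exists_finset_norm_prod_sub_one_le`) all finite sub-products away from a finite `S₀` lie
within `1/2` of `1`; their principal logarithms are then additive
(`sum_log_eq_log_prod_of_forall_norm_prod_sub_one_le`) with all finite sub-sums bounded by `3/4`, so
the real and imaginary parts of `log (f i)` are absolutely summable (bounded partial sums of either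
sign), and `‖f i - 1‖ = ‖exp (log (f i)) - 1‖ ≤ 2 ‖log (f i)‖`. [folklore] -/
theorem _root_.HasProd.summable_norm_sub_one (hf : HasProd f a) (ha : a ≠ 0) :
    Summable fun i => ‖f i - 1‖ := by
  classical
  obtain ⟨S₀, hS₀⟩ := hf.exists_finset_norm_prod_sub_one_le ha (by norm_num : (0 : ℝ) < 1 / 2)
  have hadd := sum_log_eq_log_prod_of_forall_norm_prod_sub_one_le hS₀
  -- bound on finite sub-sums of logarithms away from `S₀`
  have hsum : ∀ T : Finset ι, Disjoint T S₀ → ‖∑ i ∈ T, log (f i)‖ ≤ 3 / 4 := by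
    intro T hT
    rw [hadd T hT]
    have h1 := hS₀ T hT
    have := norm_log_one_add_half_le_self h1
    rw [add_sub_cancel] at this
    linarith
  -- individual factors away from `S₀`
  have hone : ∀ i, i ∉ S₀ → ‖f i - 1‖ ≤ 1 / 2 := fun i hi => by
    simpa using hS₀ {i} (Finset.disjoint_singleton_left.mpr hi)
  have hlogi : ∀ i, i ∉ S₀ → ‖log (f i)‖ ≤ 3 / 4 := fun i hi => by
    have h1 := hone i hi
    have := norm_log_one_add_half_le_self h1
    rw [add_sub_cancel] at this
    linarith
  -- the logarithms, extended by `0` on `S₀`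
  set g : ι → ℂ := fun i => if i ∈ S₀ then 0 else log (f i) with hg
  have hgsum : ∀ T : Finset ι, ‖∑ i ∈ T, g i‖ ≤ 3 / 4 := by
    intro T
    have : ∑ i ∈ T, g i = ∑ i ∈ T.filter (· ∉ S₀), log (f i) := by
      rw [Finset.sum_filter]
      refine Finset.sum_congr rfl fun i _ => ?_
      by_cases hi : i ∈ S₀ <;> simp [hg, hi]
    rw [this]
    exact hsum _ (Finset.disjoint_left.mpr fun i hi => (Finset.mem_filter.mp hi).2)
  -- real parts: bounded partial sums of absolute values
  have hre : Summable fun i => |(g i).re| := by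
    refine summable_of_sum_le (fun i => abs_nonneg _) (c := 3 / 2) fun T => ?_
    rw [← Finset.sum_filter_add_sum_filter_not T (fun i => 0 ≤ (g i).re)]
    have hp : ∑ i ∈ T.filter (fun i => 0 ≤ (g i).re), |(g i).re| =
        (∑ i ∈ T.filter (fun i => 0 ≤ (g i).re), g i).re := by
      rw [re_sum]
      exact Finset.sum_congr rfl fun i hi => abs_of_nonneg (Finset.mem_filter.mp hi).2
    have hn : ∑ i ∈ T.filter (fun i => ¬ 0 ≤ (g i).re), |(g i).re| =
        -(∑ i ∈ T.filter (fun i => ¬ 0 ≤ (g i).re), g i).re := by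
      rw [re_sum, ← Finset.sum_neg_distrib]
      exact Finset.sum_congr rfl fun i hi =>
        abs_of_neg (lt_of_not_ge (Finset.mem_filter.mp hi).2)
    rw [hp, hn]
    have h1 := (abs_re_le_norm _).trans (hgsum (T.filter (fun i => 0 ≤ (g i).re)))
    have h2 := (abs_re_le_norm _).trans (hgsum (T.filter (fun i => ¬ 0 ≤ (g i).re)))
    have h1' := (le_abs_self _).trans h1
    have h2' := (neg_le_abs _).trans h2
    linarith
  -- imaginary parts likewise
  have him : Summable fun i => |(g i).im| := by
    refine summable_of_sum_le (fun i => abs_nonneg _) (c := 3 / 2) fun T => ?_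
    rw [← Finset.sum_filter_add_sum_filter_not T (fun i => 0 ≤ (g i).im)]
    have hp : ∑ i ∈ T.filter (fun i => 0 ≤ (g i).im), |(g i).im| =
        (∑ i ∈ T.filter (fun i => 0 ≤ (g i).im), g i).im := by
      rw [im_sum]
      exact Finset.sum_congr rfl fun i hi => abs_of_nonneg (Finset.mem_filter.mp hi).2
    have hn : ∑ i ∈ T.filter (fun i => ¬ 0 ≤ (g i).im), |(g i).im| =
        -(∑ i ∈ T.filter (fun i => ¬ 0 ≤ (g i).im), g i).im := by
      rw [im_sum, ← Finset.sum_neg_distrib]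
      exact Finset.sum_congr rfl fun i hi =>
        abs_of_neg (lt_of_not_ge (Finset.mem_filter.mp hi).2)
    rw [hp, hn]
    have h1 := (abs_im_le_norm _).trans (hgsum (T.filter (fun i => 0 ≤ (g i).im)))
    have h2 := (abs_im_le_norm _).trans (hgsum (T.filter (fun i => ¬ 0 ≤ (g i).im)))
    have h1' := (le_abs_self _).trans h1
    have h2' := (neg_le_abs _).trans h2
    linarith
  have hgnorm : Summable fun i => ‖g i‖ :=
    (hre.add him).of_nonneg_of_le (fun i => norm_nonneg _)
      (fun i => norm_le_abs_re_add_abs_im _)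
  -- `‖f i - 1‖ ≤ 2 ‖g i‖` off `S₀`; on `S₀` use the finitely supported remainder
  set r : ι → ℝ := fun i => if i ∈ S₀ then ‖f i - 1‖ else 0 with hr
  have hrsum : Summable r := by
    refine summable_of_hasFiniteSupport ((S₀ : Set ι).toFinite.subset fun i hi => ?_)
    by_contra h
    exact hi (by simp [hr, show i ∉ S₀ from h])
  refine (hrsum.add (hgnorm.mul_left 2)).of_nonneg_of_le (fun i => norm_nonneg _) fun i => ?_
  by_cases hi : i ∈ S₀
  · simp [hr, hg, hi]
  · simp only [hr, hg, hi, if_false, zero_add]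
    have hgi : ‖log (f i)‖ ≤ 1 := (hlogi i hi).trans (by norm_num)
    have := norm_exp_sub_one_le hgi
    rwa [exp_log (fun h0 => by have := hone i hi; rw [h0] at this; norm_num at this)] at this

/-- `Multipliable` form: an unconditionally multipliable family in `ℂ` with `∏' f ≠ 0` has
`∑ ‖f i - 1‖ < ∞`. [folklore] -/
theorem _root_.Multipliable.summable_norm_sub_one (hf : Multipliable f) (h0 : ∏' i, f i ≠ 0) :
    Summable fun i => ‖f i - 1‖ :=
  hf.hasProd.summable_norm_sub_one h0

/-- Inverting the factors: if `∑ ‖f i - 1‖ < ∞` then `∑ ‖(f i)⁻¹ - 1‖ < ∞` (the factors tend to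
`1`, and `‖z⁻¹ - 1‖ = ‖z - 1‖ / ‖z‖ ≤ 2 ‖z - 1‖` once `‖z - 1‖ ≤ 1/2`). [folklore] -/
theorem _root_.Summable.summable_norm_inv_sub_one (hf : Summable fun i => ‖f i - 1‖) :
    Summable fun i => ‖(f i)⁻¹ - 1‖ := by
  have hsmall : ∀ᶠ i in cofinite, ‖f i - 1‖ ≤ 1 / 2 := by
    have := hf.tendsto_cofinite_zero
    exact (this.eventually (ge_mem_nhds (by norm_num : (0 : ℝ) < 1 / 2))).mono fun i hi => hi
  refine (hf.mul_left 2).of_norm_bounded_eventually ?_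
  filter_upwards [hsmall] with i hi
  rw [Real.norm_eq_abs, abs_of_nonneg (norm_nonneg _)]
  have hfi : (1 : ℝ) / 2 ≤ ‖f i‖ := by
    have : ‖(1 : ℂ)‖ ≤ ‖f i‖ + ‖f i - 1‖ := by
      calc ‖(1 : ℂ)‖ = ‖f i - (f i - 1)‖ := by rw [sub_sub_cancel]
        _ ≤ ‖f i‖ + ‖f i - 1‖ := norm_sub_le _ _
    rw [norm_one] at this
    linarith
  have hf0 : f i ≠ 0 := fun h => by rw [h, norm_zero] at hfi; norm_num at hfi
  have : (f i)⁻¹ - 1 = -(f i - 1) / f i := by field_simp; ring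
  rw [this, norm_div, norm_neg, div_le_iff₀ (by linarith)]
  nlinarith [norm_nonneg (f i - 1)]

end ProductToSum

/-! ### A raw pole at `s = 1` forces absolute convergence of the partial Asai product near `1⁺` -/

section RawPole

open NumberField IsDedekindDomain Polynomial

variable {F E : Type} [Field F] [NumberField F] [Field E] [Algebra F E]

/-- **A raw pole makes the partial Asai product large near `1⁺`.** If
`(s - 1) · L^S(s, A, As^η) → r ≠ 0` as `s → 1`, `Re s > 1` (the raw-limit rendering of a pole used by
`AutomorphicRepData.HasAsaiPole`), then `‖L^S(s, A, As^η)‖ > 1` for all `s` near `1` with `Re s > 1`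
(`‖s - 1‖ · ‖L^S(s)‖ ≥ ‖r‖ / 2` while `‖s - 1‖ < ‖r‖ / 2`). [folklore] -/
theorem eventually_one_lt_norm_partialAsaiL_of_tendsto {S : Set (HeightOneSpectrum (𝓞 F))}
    {c : E ≃ₐ[F] E} {A : SatakeFamily E} {η : ℤˣ} {r : ℂ} (hr : r ≠ 0)
    (h : Tendsto (fun s => (s - 1) * partialAsaiL S c A η s) (𝓝[{s : ℂ | 1 < s.re}] 1) (𝓝 r)) :
    ∀ᶠ s in 𝓝[{s : ℂ | 1 < s.re}] 1, 1 < ‖partialAsaiL S c A η s‖ := by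
  have hr2 : 0 < ‖r‖ / 2 := half_pos (norm_pos_iff.mpr hr)
  have h1 : ∀ᶠ s in 𝓝[{s : ℂ | 1 < s.re}] 1, ‖(s - 1) * partialAsaiL S c A η s - r‖ < ‖r‖ / 2 := by
    have := h (Metric.ball_mem_nhds r hr2)
    filter_upwards [this] with s hs
    simpa [dist_eq_norm] using hs
  have h2 : ∀ᶠ s in 𝓝[{s : ℂ | 1 < s.re}] 1, ‖s - 1‖ < ‖r‖ / 2 := by
    have := tendsto_sub_one_nhdsWithin_one_lt_re (Metric.ball_mem_nhds (0 : ℂ) hr2)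
    filter_upwards [this] with s hs
    simpa [dist_eq_norm] using hs
  filter_upwards [h1, h2] with s hs1 hs2
  set L := partialAsaiL S c A η s with hL
  have hrle : ‖r‖ < ‖s - 1‖ * ‖L‖ + ‖r‖ / 2 := by
    calc ‖r‖ = ‖(s - 1) * L - ((s - 1) * L - r)‖ := by rw [sub_sub_cancel]
      _ ≤ ‖(s - 1) * L‖ + ‖(s - 1) * L - r‖ := norm_sub_le _ _
      _ < ‖s - 1‖ * ‖L‖ + ‖r‖ / 2 := by rw [norm_mul]; linarith
  have hkey : ‖r‖ / 2 < ‖r‖ / 2 * ‖L‖ := by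
    have : ‖s - 1‖ * ‖L‖ ≤ ‖r‖ / 2 * ‖L‖ := mul_le_mul_of_nonneg_right hs2.le (norm_nonneg _)
    linarith
  by_contra hle
  have : ‖r‖ / 2 * ‖L‖ ≤ ‖r‖ / 2 * 1 := mul_le_mul_of_nonneg_left (not_lt.mp hle) hr2.le
  linarith

/-- **A raw pole forces absolute convergence of the partial Asai Euler product near `1⁺`.** If
`(s - 1) · L^S(s, A, As^η) → r ≠ 0` (`s → 1`, `Re s > 1`) for the unconditional `tprod`
`L^S = partialAsaiL S c A η` (junk value `1` off its domain of multipliability), then for all `s`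
near `1` with `Re s > 1`: the Euler product `∏_{v ∉ S} P_v(s)⁻¹`,
`P_v(s) = (asaiLocalPolynomial c A η w_v)(q_v^{-s})`, is multipliable (its value `L^S(s)` has norm
`> 1`, so it is not the junk value), `L^S(s) ≠ 0`, no local factor vanishes, `P_v(s) ≠ 0`
(`HasProd.ne_zero_apply`), and the product converges absolutely, `∑_{v ∉ S} ‖P_v(s) - 1‖ < ∞`
(`HasProd.summable_norm_sub_one`, `Summable.summable_norm_inv_sub_one`). In particular the raw-limit
currency of `AutomorphicRepData.HasAsaiPole` carries, near `1⁺`, the absolute convergence that the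
printed Asai `L`-functions (Flicker 1988, Theorem p. 297; Mok 2015, §2.5) have only on a right
half-plane. [folklore] -/
theorem eventually_summable_norm_sub_one_of_tendsto_partialAsaiL
    {S : Set (HeightOneSpectrum (𝓞 F))} {c : E ≃ₐ[F] E} {A : SatakeFamily E} {η : ℤˣ} {r : ℂ}
    (hr : r ≠ 0)
    (h : Tendsto (fun s => (s - 1) * partialAsaiL S c A η s) (𝓝[{s : ℂ | 1 < s.re}] 1) (𝓝 r)) :
    ∀ᶠ s in 𝓝[{s : ℂ | 1 < s.re}] 1,
      Multipliable (fun v : {v : HeightOneSpectrum (𝓞 F) // v ∉ S} =>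
        ((asaiLocalPolynomial c A η (placeAbove E v.1)).eval ((v.1.residueCard : ℂ) ^ (-s)))⁻¹) ∧
      partialAsaiL S c A η s ≠ 0 ∧
      (∀ v : {v : HeightOneSpectrum (𝓞 F) // v ∉ S},
        (asaiLocalPolynomial c A η (placeAbove E v.1)).eval ((v.1.residueCard : ℂ) ^ (-s)) ≠ 0) ∧
      Summable (fun v : {v : HeightOneSpectrum (𝓞 F) // v ∉ S} =>
        ‖(asaiLocalPolynomial c A η (placeAbove E v.1)).eval ((v.1.residueCard : ℂ) ^ (-s)) - 1‖) := by
  filter_upwards [eventually_one_lt_norm_partialAsaiL_of_tendsto hr h] with s hs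
  set f : {v : HeightOneSpectrum (𝓞 F) // v ∉ S} → ℂ := fun v =>
    ((asaiLocalPolynomial c A η (placeAbove E v.1)).eval ((v.1.residueCard : ℂ) ^ (-s)))⁻¹ with hf
  have hL : partialAsaiL S c A η s = ∏' v, f v := rfl
  have hne1 : partialAsaiL S c A η s ≠ 1 := fun h1 => by rw [h1, norm_one] at hs; exact lt_irrefl _ hs
  have hne0 : partialAsaiL S c A η s ≠ 0 := fun h0 => by
    rw [h0, norm_zero] at hs; exact absurd hs (by norm_num)
  have hmul : Multipliable f := by
    by_contra hm
    exact hne1 (hL.trans (tprod_eq_one_of_not_multipliable hm))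
  have hprod : HasProd f (partialAsaiL S c A η s) := hL ▸ hmul.hasProd
  have hfac : ∀ v, f v ≠ 0 := hprod.ne_zero_apply hne0
  have hsum : Summable fun v => ‖f v - 1‖ := hprod.summable_norm_sub_one hne0
  refine ⟨hmul, hne0, fun v h0 => hfac v ?_, ?_⟩
  · simp [hf, h0]
  · simpa [hf] using hsum.summable_norm_inv_sub_one

end RawPole

/-! ### Three lemmas of elementary analysis: Baire, Cauchy's estimate in mean, horizontal averaging -/

section Analysis

open Metric Set MeasureTheory intervalIntegral Real Polynomial

/-- **Baire: pointwise absolute convergence is locally uniformly bounded somewhere.** If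
non-negative continuous functions `g k : ℂ → ℝ` are summable at every point of a non-empty open set
`U`, then on some ball inside `U` all their finite partial sums are bounded by one constant `M`
(the closed sets `{s : ∑_{k ∈ T} g k s ≤ n for all finite T}` cover a closed ball of `U`, and
Baire's theorem in `ℂ` applies). [folklore] -/
theorem exists_ball_forall_sum_le_of_summable {κ : Type*} {g : κ → ℂ → ℝ}
    (hg : ∀ k, Continuous (g k)) (h0 : ∀ k s, 0 ≤ g k s) {U : Set ℂ} (hU : IsOpen U)
    (hne : U.Nonempty) (hsum : ∀ s ∈ U, Summable fun k => g k s) :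
    ∃ z : ℂ, ∃ ρ M : ℝ, 0 < ρ ∧ ball z ρ ⊆ U ∧
      ∀ s ∈ ball z ρ, ∀ T : Finset κ, ∑ k ∈ T, g k s ≤ M := by
  classical
  obtain ⟨z₀, hz₀⟩ := hne
  obtain ⟨ε, hε, hball⟩ := Metric.isOpen_iff.mp hU z₀ hz₀
  set δ₁ : ℝ := ε / 2 with hδ₁
  have hδ₁0 : 0 < δ₁ := by positivity
  have hcb : closedBall z₀ δ₁ ⊆ U := (closedBall_subset_ball (by linarith)).trans hball
  -- the closed sets
  set C : ℕ → Set ℂ := fun n =>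
    (closedBall z₀ δ₁ ∩ ⋂ T : Finset κ, {s : ℂ | ∑ k ∈ T, g k s ≤ n}) ∪ (ball z₀ δ₁)ᶜ with hC
  have hCc : ∀ n, IsClosed (C n) := fun n =>
    (isClosed_closedBall.inter (isClosed_iInter fun T =>
      isClosed_le (continuous_finsetSum T fun k _ => hg k) continuous_const)).union
      isOpen_ball.isClosed_compl
  have hcov : ⋃ n, C n = univ := by
    refine eq_univ_of_forall fun s => ?_
    by_cases hs : s ∈ ball z₀ δ₁
    · have hsU : s ∈ U := hcb (ball_subset_closedBall hs)
      obtain ⟨n, hn⟩ := exists_nat_ge (∑' k, g k s)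
      refine mem_iUnion.mpr ⟨n, Or.inl ⟨ball_subset_closedBall hs, mem_iInter.mpr fun T => ?_⟩⟩
      exact ((hsum s hsU).sum_le_tsum T fun k _ => h0 k s).trans hn
    · exact mem_iUnion.mpr ⟨0, Or.inr hs⟩
  have hdense := dense_iUnion_interior_of_closed hCc hcov
  obtain ⟨s₁, hs₁ball, hs₁int⟩ :=
    hdense.inter_open_nonempty (ball z₀ δ₁) isOpen_ball ⟨z₀, mem_ball_self hδ₁0⟩
  obtain ⟨n, hn⟩ := mem_iUnion.mp hs₁int
  obtain ⟨ρ₁, hρ₁, hρ₁sub⟩ := Metric.isOpen_iff.mp isOpen_interior s₁ hn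
  obtain ⟨ρ₂, hρ₂, hρ₂sub⟩ := Metric.isOpen_iff.mp isOpen_ball s₁ hs₁ball
  refine ⟨s₁, min ρ₁ ρ₂, n, lt_min hρ₁ hρ₂, fun s hs =>
    hcb (ball_subset_closedBall (hρ₂sub (ball_subset_ball (min_le_right _ _) hs))), ?_⟩
  intro s hs T
  have h1 : s ∈ C n := interior_subset (hρ₁sub (ball_subset_ball (min_le_left _ _) hs))
  have h2 : s ∈ ball z₀ δ₁ := hρ₂sub (ball_subset_ball (min_le_right _ _) hs)
  rcases h1 with h1 | h1
  · exact (mem_iInter.mp h1.2) T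
  · exact absurd h2 h1

/-- **Cauchy's integral formula as an estimate by the mean over a circle.** For an entire function
`Φ`, a radius `r > 0` and a point `w` with `‖w‖ ≤ θ₀ r`, `θ₀ < 1` (any real `θ₀`):
`‖Φ w‖ ≤ (1 - θ₀)⁻¹ · (2π)⁻¹ ∫₀^{2π} ‖Φ(r e^{iθ})‖ dθ` (`|ζ - w| ≥ (1 - θ₀) r` on the circle).
[folklore] -/
theorem norm_le_mean_circle_of_differentiable {Φ : ℂ → ℂ} (hΦ : Differentiable ℂ Φ)
    {r θ₀ : ℝ} (hr : 0 < r) (hθ₁ : θ₀ < 1) {w : ℂ} (hw : ‖w‖ ≤ θ₀ * r) :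
    ‖Φ w‖ ≤ (1 - θ₀)⁻¹ * ((2 * π)⁻¹ * ∫ θ in (0 : ℝ)..2 * π, ‖Φ (circleMap 0 r θ)‖) := by
  have hwr : ‖w‖ < r := hw.trans_lt (by nlinarith)
  have hwball : w ∈ ball (0 : ℂ) r := by simpa using hwr
  have hcauchy := (hΦ.differentiableOn (s := closedBall (0 : ℂ) r)).circleIntegral_sub_inv_smul
    hwball
  -- `Φ w = (2πi)⁻¹ ∮ (z - w)⁻¹ Φ z`
  have hΦw : Φ w = (2 * π * I : ℂ)⁻¹ • ∮ z in C(0, r), (z - w)⁻¹ • Φ z := by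
    rw [hcauchy, smul_smul, inv_mul_cancel₀ (by simp [Real.pi_ne_zero, I_ne_zero]), one_smul]
  -- estimate of the circle integral
  have hint : ‖∮ z in C(0, r), (z - w)⁻¹ • Φ z‖ ≤
      ∫ θ in (0 : ℝ)..2 * π, (1 - θ₀)⁻¹ * ‖Φ (circleMap 0 r θ)‖ := by
    rw [circleIntegral]
    refine norm_integral_le_of_norm_le Real.two_pi_pos.le (Eventually.of_forall fun θ _ => ?_) ?_
    · have hz : ‖circleMap 0 r θ‖ = r := by simp [abs_of_pos hr]
      have hzw : (1 - θ₀) * r ≤ ‖circleMap 0 r θ - w‖ := by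
        have := norm_sub_norm_le (circleMap 0 r θ) w
        rw [hz] at this
        nlinarith
      have hzw0 : 0 < ‖circleMap 0 r θ - w‖ := lt_of_lt_of_le (by nlinarith) hzw
      rw [norm_smul, norm_smul, deriv_circleMap, norm_mul, norm_I, mul_one, norm_inv, hz]
      calc r * (‖circleMap 0 r θ - w‖⁻¹ * ‖Φ (circleMap 0 r θ)‖)
          ≤ r * (((1 - θ₀) * r)⁻¹ * ‖Φ (circleMap 0 r θ)‖) := by
            gcongr
        _ = (1 - θ₀)⁻¹ * ‖Φ (circleMap 0 r θ)‖ := by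
            field_simp
    · exact ((hΦ.continuous.comp (continuous_circleMap 0 r)).norm.const_smul
        ((1 - θ₀)⁻¹)).intervalIntegrable _ _
  rw [hΦw, norm_smul, norm_inv, intervalIntegral.integral_const_mul] at *
  have h2π : ‖(2 * π * I : ℂ)‖ = 2 * π := by
    simp [abs_of_pos Real.pi_pos]
  rw [h2π]
  calc (2 * π)⁻¹ * ‖∮ z in C(0, r), (z - w)⁻¹ • Φ z‖
      ≤ (2 * π)⁻¹ * ((1 - θ₀)⁻¹ * ∫ θ in (0 : ℝ)..2 * π, ‖Φ (circleMap 0 r θ)‖) := by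
        gcongr
    _ = (1 - θ₀)⁻¹ * ((2 * π)⁻¹ * ∫ θ in (0 : ℝ)..2 * π, ‖Φ (circleMap 0 r θ)‖) := by ring

/-- **Averaging a `2π`-periodic non-negative function along a fast linear phase.** If `Ψ ≥ 0` is
continuous and `2π`-periodic and `λ ≥ 2π / ρ`, the integral of `t ↦ Ψ(-λ t)` over an interval of
length `2ρ` is at least `ρ` times the mean of `Ψ` (the interval contains at least
`⌊ρ λ / π⌋ ≥ ρ λ / π - 1 ≥ ρ λ / (2 π)` full periods). [folklore] -/
theorem mul_mean_le_integral_comp_of_periodic {Ψ : ℝ → ℝ} (hΨc : Continuous Ψ)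
    (hΨ0 : ∀ x, 0 ≤ Ψ x) (hper : Function.Periodic Ψ (2 * π)) {lam ρ : ℝ} (hρ : 0 < ρ)
    (hlam : 2 * π / ρ ≤ lam) (t₁ : ℝ) :
    ρ * ((2 * π)⁻¹ * ∫ θ in (0 : ℝ)..2 * π, Ψ θ) ≤ ∫ t in t₁..t₁ + 2 * ρ, Ψ (-(lam * t)) := by
  have hint : ∀ a b : ℝ, IntervalIntegrable Ψ volume a b := fun a b =>
    hΨc.intervalIntegrable a b
  have hlam0 : 0 < lam := lt_of_lt_of_le (by positivity) hlam
  set I : ℝ := ∫ θ in (0 : ℝ)..2 * π, Ψ θ with hI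
  have hI0 : 0 ≤ I := intervalIntegral.integral_nonneg Real.two_pi_pos.le fun x _ => hΨ0 x
  -- substitution `x = -λ t`
  set a : ℝ := -lam * (t₁ + 2 * ρ) with ha
  have hsub : ∫ t in t₁..t₁ + 2 * ρ, Ψ (-(lam * t)) = lam⁻¹ * ∫ x in a..a + 2 * ρ * lam, Ψ x := by
    have h1 : ∫ t in t₁..t₁ + 2 * ρ, Ψ (-(lam * t)) = ∫ t in t₁..t₁ + 2 * ρ, Ψ (-lam * t) := by
      simp [neg_mul]
    rw [h1, intervalIntegral.integral_comp_mul_left Ψ (neg_ne_zero.mpr hlam0.ne'),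
      intervalIntegral.integral_symm, smul_eq_mul]
    have h2 : -lam * t₁ = a + 2 * ρ * lam := by rw [ha]; ring
    rw [h2, inv_neg]
    ring
  -- number of full periods
  set n : ℕ := ⌊2 * ρ * lam / (2 * π)⌋₊ with hn
  have hnle : (n : ℝ) * (2 * π) ≤ 2 * ρ * lam := by
    have := Nat.floor_le (by positivity : 0 ≤ 2 * ρ * lam / (2 * π))
    rw [← hn] at this
    calc (n : ℝ) * (2 * π) ≤ 2 * ρ * lam / (2 * π) * (2 * π) := by gcongr
      _ = 2 * ρ * lam := by field_simp
  have hnge : 2 * ρ * lam / (2 * π) - 1 ≤ n := by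
    have := Nat.lt_floor_add_one (2 * ρ * lam / (2 * π))
    rw [← hn] at this
    linarith
  -- `∫_a^{a + n 2π} Ψ = n I`
  have hper' : ∫ x in a..a + n * (2 * π), Ψ x = n * I := by
    have := hper.intervalIntegral_add_zsmul_eq (n : ℤ) a hint
    rw [zsmul_eq_mul, zsmul_eq_mul, Int.cast_natCast, hper.intervalIntegral_add_eq a 0,
      zero_add] at this
    exact this
  -- monotonicity in the upper limit
  have hmono : ∫ x in a..a + n * (2 * π), Ψ x ≤ ∫ x in a..a + 2 * ρ * lam, Ψ x := by
    rw [← intervalIntegral.integral_add_adjacent_intervals (hint a (a + n * (2 * π)))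
      (hint (a + n * (2 * π)) (a + 2 * ρ * lam))]
    have : 0 ≤ ∫ x in (a + n * (2 * π))..(a + 2 * ρ * lam), Ψ x :=
      intervalIntegral.integral_nonneg (by linarith) fun x _ => hΨ0 x
    linarith
  rw [hsub]
  have hkey : ρ * ((2 * π)⁻¹ * I) ≤ lam⁻¹ * (n * I) := by
    -- `ρ / (2π) ≤ n / λ` since `n ≥ ρ λ / π - 1` and `1 / λ ≤ ρ / (2 π)`
    have h1 : lam⁻¹ ≤ ρ / (2 * π) := by
      rw [inv_eq_one_div, div_le_div_iff₀ hlam0 (by positivity), one_mul]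
      calc 2 * π = 2 * π / ρ * ρ := by field_simp
        _ ≤ lam * ρ := by gcongr
        _ = ρ * lam := mul_comm _ _
    have h2 : ρ * (2 * π)⁻¹ ≤ lam⁻¹ * n := by
      have h3 : lam⁻¹ * (2 * ρ * lam / (2 * π) - 1) ≤ lam⁻¹ * n :=
        mul_le_mul_of_nonneg_left hnge (inv_nonneg.mpr hlam0.le)
      have h4 : lam⁻¹ * (2 * ρ * lam / (2 * π) - 1) = ρ / π - lam⁻¹ := by
        field_simp
      rw [h4] at h3
      have h5 : ρ * (2 * π)⁻¹ = ρ / π - ρ / (2 * π) := by field_simp; ring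
      rw [h5]
      linarith
    calc ρ * ((2 * π)⁻¹ * I) = ρ * (2 * π)⁻¹ * I := by ring
      _ ≤ lam⁻¹ * n * I := mul_le_mul_of_nonneg_right h2 hI0
      _ = lam⁻¹ * (n * I) := by ring
  calc ρ * ((2 * π)⁻¹ * I) ≤ lam⁻¹ * (n * I) := hkey
    _ = lam⁻¹ * ∫ x in a..a + n * (2 * π), Ψ x := by rw [hper']
    _ ≤ lam⁻¹ * ∫ x in a..a + 2 * ρ * lam, Ψ x :=
        mul_le_mul_of_nonneg_left hmono (inv_nonneg.mpr hlam0.le)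


/-- **Points of a vertical line as points of a circle in the variable `T = q^{-s}`**:
`q^{-s} = q^{-Re s} · e^{-i (log q) Im s}`, i.e. `q^{-(σ + it)} = circleMap 0 (q^{-σ}) (-(log q) t)`.
[folklore] -/
theorem natCast_cpow_neg_eq_circleMap {q : ℕ} (hq : 0 < q) (s : ℂ) :
    (q : ℂ) ^ (-s) = circleMap 0 ((q : ℝ) ^ (-s.re)) (-(Real.log q * s.im)) := by
  have hq0 : (q : ℂ) ≠ 0 := Nat.cast_ne_zero.mpr hq.ne'
  have hqr : (0 : ℝ) < q := Nat.cast_pos.mpr hq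
  rw [Complex.cpow_def_of_ne_zero hq0, circleMap, zero_add, Real.rpow_def_of_pos hqr,
    Complex.ofReal_exp, ← Complex.exp_add]
  congr 1
  have hlog : Complex.log (q : ℂ) = (Real.log q : ℂ) := by
    rw [← Complex.ofReal_natCast]
    exact (Complex.ofReal_log hqr.le).symm
  rw [hlog]
  apply Complex.ext
  · simp; ring
  · simp

/-- **From a locally uniform bound on a ball to a summable bound on a half-plane** (the heart of
the raw-to-continued bridge). Let `P_k(s) = Q_k(q_k^{-s})` for polynomials `Q_k` and integers
`q_k ≥ 2` of which only finitely many lie below any bound. If on a ball `B(z, ρ)` all finite sums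
`∑_{k ∈ T} ‖P_k(s) - 1‖` are `≤ M`, then for every `τ > 0` there is a summable `u ≥ 0` with
`‖P_k(s) - 1‖ ≤ u_k` on the half-plane `Re s ≥ Re z + τ`. Proof: with `r_k = q_k^{-Re z}` and
`m_k` the mean of `‖Q_k - 1‖` over the circle `|T| = r_k`, Cauchy's formula gives
`‖P_k(s) - 1‖ ≤ (1 - 2^{-τ})⁻¹ m_k` for `Re s ≥ Re z + τ` (`|q_k^{-s}| ≤ q_k^{-τ} r_k ≤ 2^{-τ} r_k`,
`norm_le_mean_circle_of_differentiable`); and along the horizontal diameter of the ball,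
`t ↦ q_k^{-(Re z + it)}` runs through the circle `|T| = r_k` with angular speed `log q_k`, so for
`log q_k ≥ 4π/ρ` the integral of `‖P_k(Re z + it) - 1‖` over `|t - Im z| ≤ ρ/2` is `≥ (ρ/2) m_k`
(`mul_mean_le_integral_comp_of_periodic`); summing over finitely many such `k` and exchanging sum and
integral bounds `∑ m_k` by `2M`, and the finitely many `k` with `log q_k < 4π/ρ` do not matter.
[folklore] -/
theorem exists_summable_norm_sub_one_le_of_forall_sum_le {κ : Type*} {q : κ → ℕ}
    (hq : ∀ k, 1 < q k) (hfin : ∀ X : ℝ, {k | (q k : ℝ) ≤ X}.Finite) (Q : κ → ℂ[X])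
    {z : ℂ} {ρ M : ℝ} (hρ : 0 < ρ)
    (hM : ∀ s ∈ Metric.ball z ρ, ∀ T : Finset κ,
      ∑ k ∈ T, ‖(Q k).eval ((q k : ℂ) ^ (-s)) - 1‖ ≤ M)
    {τ : ℝ} (hτ : 0 < τ) :
    ∃ u : κ → ℝ, (∀ k, 0 ≤ u k) ∧ Summable u ∧
      ∀ (k : κ) (s : ℂ), z.re + τ ≤ s.re → ‖(Q k).eval ((q k : ℂ) ^ (-s)) - 1‖ ≤ u k := by
  classical
  -- radii, the entire functions `Φ_k = Q_k - 1`, their restrictions to the circles and the means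
  set r : κ → ℝ := fun k => (q k : ℝ) ^ (-z.re) with hrdef
  have hq0 : ∀ k, (0 : ℝ) < q k := fun k => by exact_mod_cast zero_lt_one.trans (hq k)
  have hr : ∀ k, 0 < r k := fun k => Real.rpow_pos_of_pos (hq0 k) _
  set Φ : κ → ℂ → ℂ := fun k T => (Q k).eval T - 1 with hΦdef
  have hΦd : ∀ k, Differentiable ℂ (Φ k) := fun k => (Q k).differentiable.sub_const 1
  set Ψ : κ → ℝ → ℝ := fun k θ => ‖Φ k (circleMap 0 (r k) θ)‖ with hΨdef
  have hΨc : ∀ k, Continuous (Ψ k) := fun k =>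
    ((hΦd k).continuous.comp (continuous_circleMap 0 (r k))).norm
  have hΨ0 : ∀ k θ, 0 ≤ Ψ k θ := fun k θ => norm_nonneg _
  have hΨp : ∀ k, Function.Periodic (Ψ k) (2 * π) := fun k θ => by
    simp only [hΨdef, periodic_circleMap 0 (r k) θ]
  set m : κ → ℝ := fun k => (2 * π)⁻¹ * ∫ θ in (0 : ℝ)..2 * π, Ψ k θ with hmdef
  have hm0 : ∀ k, 0 ≤ m k := fun k => mul_nonneg (inv_nonneg.mpr Real.two_pi_pos.le)
    (intervalIntegral.integral_nonneg Real.two_pi_pos.le fun θ _ => hΨ0 k θ)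
  -- (1) the bound on the half-plane `Re s ≥ Re z + τ`
  set θ₀ : ℝ := (2 : ℝ) ^ (-τ) with hθ₀def
  have hθ₀1 : θ₀ < 1 := Real.rpow_lt_one_of_one_lt_of_neg (by norm_num) (by linarith)
  have hbound : ∀ (k : κ) (s : ℂ), z.re + τ ≤ s.re →
      ‖(Q k).eval ((q k : ℂ) ^ (-s)) - 1‖ ≤ (1 - θ₀)⁻¹ * m k := by
    intro k s hs
    have hq1 : (1 : ℝ) ≤ q k := by exact_mod_cast (hq k).le
    have hq2 : (2 : ℝ) ≤ q k := by exact_mod_cast hq k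
    have hw : ‖(q k : ℂ) ^ (-s)‖ ≤ θ₀ * r k := by
      rw [Complex.norm_natCast_cpow_of_pos (zero_lt_one.trans (hq k)), Complex.neg_re]
      calc (q k : ℝ) ^ (-s.re) ≤ (q k : ℝ) ^ (-(z.re + τ)) :=
            Real.rpow_le_rpow_of_exponent_le hq1 (by linarith)
        _ = (q k : ℝ) ^ (-τ) * r k := by
            rw [hrdef, neg_add, Real.rpow_add (hq0 k)]; ring
        _ ≤ θ₀ * r k := mul_le_mul_of_nonneg_right
            (Real.rpow_le_rpow_of_nonpos (by norm_num) hq2 (by linarith)) (hr k).le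
    exact norm_le_mean_circle_of_differentiable (hΦd k) (hr k) hθ₀1 hw
  -- (2) the horizontal diameter of the ball runs through the circle `|T| = r_k`
  have hdiam : ∀ (k : κ) (t : ℝ), Ψ k (-(Real.log (q k) * t)) =
      ‖(Q k).eval ((q k : ℂ) ^ (-((z.re : ℂ) + t * I))) - 1‖ := by
    intro k t
    rw [natCast_cpow_neg_eq_circleMap (zero_lt_one.trans (hq k))]
    simp [hΨdef, hΦdef, hrdef]
  have hball : ∀ t ∈ Set.Icc (z.im - ρ / 2) (z.im - ρ / 2 + 2 * (ρ / 2)),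
      ((z.re : ℂ) + t * I) ∈ Metric.ball z ρ := by
    intro t ht
    rw [Metric.mem_ball, dist_eq_norm]
    have : ((z.re : ℂ) + t * I) - z = ((t - z.im : ℝ) : ℂ) * I := by
      apply Complex.ext <;> simp
    rw [this, norm_mul, Complex.norm_real, Complex.norm_I, mul_one, Real.norm_eq_abs]
    rw [abs_lt]
    constructor <;> linarith [ht.1, ht.2]
  -- (3) `∑_{k ∈ T} m_k ≤ 2 M` over the places with `log q_k ≥ 4π/ρ`
  have hsumT : ∀ T : Finset κ, (∀ k ∈ T, 4 * π / ρ ≤ Real.log (q k)) →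
      ∑ k ∈ T, m k ≤ 2 * M := by
    intro T hT
    have h1 : ∀ k ∈ T, ρ / 2 * m k ≤
        ∫ t in (z.im - ρ / 2)..(z.im - ρ / 2 + 2 * (ρ / 2)), Ψ k (-(Real.log (q k) * t)) :=
      fun k hk => mul_mean_le_integral_comp_of_periodic (hΨc k) (hΨ0 k) (hΨp k) (half_pos hρ)
        (by rw [show 2 * π / (ρ / 2) = 4 * π / ρ by ring]; exact hT k hk) _
    have hint : ∀ k, IntervalIntegrable (fun t => Ψ k (-(Real.log (q k) * t))) volume
        (z.im - ρ / 2) (z.im - ρ / 2 + 2 * (ρ / 2)) := fun k =>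
      ((hΨc k).comp ((continuous_const.mul continuous_id).neg)).intervalIntegrable _ _
    have h2 : ∑ k ∈ T, ∫ t in (z.im - ρ / 2)..(z.im - ρ / 2 + 2 * (ρ / 2)),
        Ψ k (-(Real.log (q k) * t)) =
        ∫ t in (z.im - ρ / 2)..(z.im - ρ / 2 + 2 * (ρ / 2)),
          ∑ k ∈ T, Ψ k (-(Real.log (q k) * t)) :=
      (intervalIntegral.integral_finsetSum fun k _ => hint k).symm
    have h3 : ∫ t in (z.im - ρ / 2)..(z.im - ρ / 2 + 2 * (ρ / 2)),
        ∑ k ∈ T, Ψ k (-(Real.log (q k) * t)) ≤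
        ∫ t in (z.im - ρ / 2)..(z.im - ρ / 2 + 2 * (ρ / 2)), M := by
      refine intervalIntegral.integral_mono_on (by linarith)
        ((continuous_finsetSum T fun k _ => (hΨc k).comp
          ((continuous_const.mul continuous_id).neg)).intervalIntegrable _ _)
        intervalIntegrable_const fun t ht => ?_
      rw [Finset.sum_congr rfl fun k _ => hdiam k t]
      exact hM _ (hball t ht) T
    have h4 : ρ / 2 * ∑ k ∈ T, m k ≤ ρ / 2 * (2 * M) := by
      rw [Finset.mul_sum]
      calc ∑ k ∈ T, ρ / 2 * m k
          ≤ ∑ k ∈ T, ∫ t in (z.im - ρ / 2)..(z.im - ρ / 2 + 2 * (ρ / 2)),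
              Ψ k (-(Real.log (q k) * t)) := Finset.sum_le_sum h1
        _ ≤ ∫ t in (z.im - ρ / 2)..(z.im - ρ / 2 + 2 * (ρ / 2)), M := h2 ▸ h3
        _ = ρ / 2 * (2 * M) := by rw [intervalIntegral.integral_const]; simp; ring
    exact le_of_mul_le_mul_left h4 (half_pos hρ)
  -- (4) summability of `m`
  have hm : Summable m := by
    set m' : κ → ℝ := fun k => if 4 * π / ρ ≤ Real.log (q k) then m k else 0 with hm'def
    have hm'0 : ∀ k, 0 ≤ m' k := fun k => by
      simp only [hm'def]; split_ifs <;> [exact hm0 k; exact le_rfl]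
    have hm' : Summable m' := by
      refine summable_of_sum_le hm'0 (c := 2 * M) fun T => ?_
      rw [Finset.sum_ite, Finset.sum_const_zero, add_zero]
      exact hsumT _ fun k hk => (Finset.mem_filter.mp hk).2
    have hrest : Summable fun k => m k - m' k := by
      refine summable_of_hasFiniteSupport ((hfin (Real.exp (4 * π / ρ))).subset fun k hk => ?_)
      simp only [Function.mem_support, ne_eq] at hk
      simp only [Set.mem_setOf_eq]
      by_cases h : 4 * π / ρ ≤ Real.log (q k)
      · exact absurd (by simp [hm'def, h]) hk
      · have := Real.exp_lt_exp.mpr (not_le.mp h)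
        rw [Real.exp_log (hq0 k)] at this
        exact this.le
    have := hm'.add hrest
    simpa using this
  refine ⟨fun k => (1 - θ₀)⁻¹ * m k, fun k => mul_nonneg (inv_nonneg.mpr (by linarith)) (hm0 k),
    hm.mul_left _, hbound⟩

/-- **Weierstrass `M`-test for an Euler product on an open set** (generic form of the accepted
`differentiableOn_partialAsaiL_of_norm_sub_one_le`): if entire functions `e_k` satisfy
`‖e_k(s) - 1‖ ≤ u_k` on an open set `U` with `∑ u_k < ∞` and do not vanish on `U`, then
`s ↦ ∏' (e_k s)⁻¹` is holomorphic and non-zero on `U`, and at each point of `U` it is the genuine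
value of the (unconditionally convergent) product (Mathlib `Summable.hasProdLocallyUniformlyOn_one_add`,
`TendstoLocallyUniformlyOn.differentiableOn`, `tprod_one_add_ne_zero_of_summable`). [folklore] -/
theorem differentiableOn_tprod_inv_of_norm_sub_one_le {κ : Type*} {e : κ → ℂ → ℂ}
    (hed : ∀ k, Differentiable ℂ (e k)) {U : Set ℂ} (hUo : IsOpen U) {u : κ → ℝ}
    (hu : Summable u) (hle : ∀ (k : κ) (s : ℂ), s ∈ U → ‖e k s - 1‖ ≤ u k)
    (hne : ∀ (k : κ) (s : ℂ), s ∈ U → e k s ≠ 0) :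
    DifferentiableOn ℂ (fun s => ∏' k, (e k s)⁻¹) U ∧
      ∀ s ∈ U, (∏' k, (e k s)⁻¹) ≠ 0 ∧ HasProd (fun k => (e k s)⁻¹) (∏' k, (e k s)⁻¹) := by
  have hprod : HasProdLocallyUniformlyOn (fun k s => 1 + (e k s - 1))
      (fun s => ∏' k, (1 + (e k s - 1))) U :=
    hu.hasProdLocallyUniformlyOn_one_add hUo (Eventually.of_forall fun k s hs => hle k s hs)
      (fun k => ((hed k).sub_const 1).continuous.continuousOn)
  set L : ℂ → ℂ := fun s => ∏' k, (1 + (e k s - 1)) with hL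
  have hLd : DifferentiableOn ℂ L U := by
    refine (hasProdLocallyUniformlyOn_iff_tendstoLocallyUniformlyOn.mp hprod).differentiableOn
      (Eventually.of_forall fun s' => ?_) hUo
    exact (Differentiable.fun_finsetProd fun v _ =>
      ((hed v).sub_const 1).const_add 1).differentiableOn
  have hpt : ∀ s ∈ U, L s ≠ 0 ∧ HasProd (fun k => (e k s)⁻¹) (L s)⁻¹ := by
    intro s hs
    have hsum : Summable fun k => ‖e k s - 1‖ :=
      hu.of_nonneg_of_le (fun k => norm_nonneg _) (fun k => hle k s hs)
    have hL0 : L s ≠ 0 :=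
      tprod_one_add_ne_zero_of_summable (fun k => by rw [add_sub_cancel]; exact hne k s hs) hsum
    have hP : HasProd (fun k => 1 + (e k s - 1)) (L s) := hprod.hasProd hs
    have hP₁ : HasProd (fun k => e k s) (L s) := by simpa only [add_sub_cancel] using hP
    have hP₂ : HasProd (fun k => (e k s)⁻¹) (L s)⁻¹ := by
      unfold HasProd at hP₁ ⊢
      simpa only [Finset.prod_inv_distrib] using hP₁.inv₀ hL0
    exact ⟨hL0, hP₂⟩
  have heq : ∀ s ∈ U, (∏' k, (e k s)⁻¹) = (L s)⁻¹ := fun s hs => (hpt s hs).2.tprod_eq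
  refine ⟨(hLd.inv fun s hs => (hpt s hs).1).congr fun s hs => heq s hs, fun s hs => ⟨?_, ?_⟩⟩
  · rw [heq s hs]; exact inv_ne_zero (hpt s hs).1
  · rw [heq s hs]; exact (hpt s hs).2

end Analysis

/-! ### The bridge: a raw pole at `s = 1` is incompatible with a holomorphic continuation -/

section Bridge

open NumberField IsDedekindDomain Polynomial

variable {F E : Type} [Field F] [NumberField F] [Field E] [Algebra F E]

omit [NumberField F] in
/-- The local Asai polynomial has constant term `1` (`det(1 - As^η(t_v) T)` at `T = 0`).
[folklore] -/
theorem eval_zero_asaiLocalPolynomial (c : E ≃ₐ[F] E) (A : SatakeFamily E) (η : ℤˣ)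
    (w : HeightOneSpectrum (𝓞 E)) : (asaiLocalPolynomial c A η w).eval 0 = 1 := by
  by_cases hw : c • w = w
  · rw [asaiLocalPolynomial_of_smul_eq A η hw, asaiInertPolynomial, eval_mul,
      eval_multiset_prod, eval_multiset_prod]
    simp
  · rw [asaiLocalPolynomial_of_smul_ne A η hw, satakePairPolynomial_eq_eulerPolynomial,
      eval_eulerPolynomial]
    simp

/-- **Local factors do not vanish far to the right**: for a polynomial `Q` with `Q(0) ≠ 0` and an
integer `q ≥ 2`, `Q(q^{-s}) ≠ 0` once `Re s` is large (`q^{-Re s} → 0` and `Q` is continuous at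
`0`). [folklore] -/
theorem eventually_eval_natCast_cpow_neg_ne_zero {q : ℕ} (hq : 1 < q) {Q : ℂ[X]}
    (hQ : Q.eval 0 ≠ 0) :
    ∀ᶠ σ : ℝ in atTop, ∀ s : ℂ, σ ≤ s.re → Q.eval ((q : ℂ) ^ (-s)) ≠ 0 := by
  have hev : ∀ᶠ T in 𝓝 (0 : ℂ), Q.eval T ≠ 0 :=
    (Q.continuous.continuousAt (x := (0 : ℂ))).eventually_ne hQ
  obtain ⟨δ, hδ, hδne⟩ := Metric.eventually_nhds_iff.mp hev
  have hq0 : (0 : ℝ) < q := by exact_mod_cast zero_lt_one.trans hq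
  have hq1 : (1 : ℝ) < q := by exact_mod_cast hq
  have hlim : Tendsto (fun σ : ℝ => (q : ℝ) ^ (-σ)) atTop (𝓝 0) := by
    have h := tendsto_rpow_atTop_of_base_lt_one (q : ℝ)⁻¹
      (by linarith [inv_pos.mpr hq0]) (inv_lt_one_of_one_lt₀ hq1)
    refine h.congr fun σ => ?_
    rw [Real.inv_rpow hq0.le, Real.rpow_neg hq0.le]
  filter_upwards [hlim.eventually (gt_mem_nhds hδ)] with σ hσ s hs
  refine hδne ?_
  rw [dist_zero_right, Complex.norm_natCast_cpow_of_pos (zero_lt_one.trans hq), Complex.neg_re]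
  exact (Real.rpow_le_rpow_of_exponent_le hq1.le (neg_le_neg hs)).trans_lt hσ

/-- **The raw-to-continued bridge: a raw pole of a partial Asai Euler product at `s = 1` is
incompatible with a holomorphic continuation at `s = 1`.**  Let `(S, A)` be any set of finite
places of `F` and Satake family over `E` (no automorphic hypothesis), `η` a sign, and suppose the
unconditional `tprod` `L^S(s) = partialAsaiL S c A η s` has a *raw pole* at `1`:
`(s - 1) L^S(s) → r ≠ 0` as `s → 1` inside `{1 < Re s}` (the currency of
`AutomorphicRepData.HasAsaiPole`). Then NO function `H` holomorphic on `{1/2 < Re s}` agrees with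
`L^S` on a right half-plane `{σ₀ < Re s}`; in other words the meromorphic continuation of
`L^S(s, A, As^η)` (when it exists) is singular at `s = 1`. Consequently a raw pole at `As^η` in
HYPOTHESIS position is *weaker* than (implied by) a pole of the continued Asai `L`-function, with
no convergence hypothesis on `1 < Re s ≤ C` — contrary to the reading "incomparable for `N ≥ 3`"
recorded in `MokWeakBaseChange.lean` ("Discrepancy") and `MokStandardBaseChangeDescentContinuation.lean`
for `Mok2014_standardBaseChange_descent`, whose `←` equivalence with its corrected statement
therefore needs only the corrected dichotomy, not the holomorphy hypothesis `hhol`; the same applies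
to `Mok2014_archimedean_parity_of_asaiSign` (AsaiSign.lean), whose docstring claim "a raw pole
forces absolute convergence of the product for `Re s > 1` and agreement with the continued function"
is made precise here. (For a raw pole in CONCLUSION position — the deprecated
`Mok2014_partialAsaiL_pole_dichotomy` — nothing changes.)

Proof. (1) Near `1⁺` the raw pole makes `‖L^S(s)‖ > 1`, so the `tprod` is a genuine unconditional
product with non-zero value; hence no local factor `P_v(s) = (asaiLocalPolynomial …)(q_v^{-s})`
vanishes and `∑_v ‖P_v(s) - 1‖ < ∞` (`eventually_summable_norm_sub_one_of_tendsto_partialAsaiL`,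
via `HasProd.summable_norm_sub_one`). (2) For `ε > 0`, Baire's theorem on the open set
`U_ε = {1 < Re s < 1 + ε} ∩ B(1, δ)` gives a ball `B(z, ρ) ⊆ U_ε` on which all finite sums
`∑_{v ∈ T} ‖P_v(s) - 1‖` are `≤ M` (`exists_ball_forall_sum_le_of_summable`). (3) Cauchy estimates on
the circles `|T| = q_v^{-Re z}` swept by the horizontal diameter of the ball, and summation over `v`,
give a summable `u` with `‖P_v(s) - 1‖ ≤ u_v` on `{Re z + ε ≤ Re s}`
(`exists_summable_norm_sub_one_le_of_forall_sum_le`). (4) Off the finite set `B = {v : u_v ≥ 1/2}`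
the product `G(s) = ∏_{v ∉ B} P_v(s)⁻¹` is then holomorphic and non-zero on `V = {Re z + ε < Re s}`
by the Weierstrass `M`-test (`differentiableOn_tprod_inv_of_norm_sub_one_le`), and
`L^S = (∏_{v ∈ B} P_v⁻¹) · G` there. (5) Far to the right `H = L^S` and the finitely many `P_v`,
`v ∈ B`, do not vanish (`eventually_eval_natCast_cpow_neg_ne_zero`), so the holomorphic functions
`H · ∏_{v ∈ B} P_v` and `G` agree far to the right, hence on the half-plane `V` (identity theorem).
(6) At points of `V` near `1⁺` no `P_v` vanishes, so `L^S = H` there; as `ε` was arbitrary,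
`L^S = H` near `1⁺`, and `L^S(s) → H(1)` contradicts the raw pole
(`not_tendsto_of_tendsto_sub_one_mul`). [folklore] -/
theorem false_of_tendsto_partialAsaiL_of_holomorphic_continuation
    {S : Set (HeightOneSpectrum (𝓞 F))} {c : E ≃ₐ[F] E} {A : SatakeFamily E} {η : ℤˣ} {r : ℂ}
    (hr : r ≠ 0)
    (hpole : Tendsto (fun s => (s - 1) * partialAsaiL S c A η s) (𝓝[{s : ℂ | 1 < s.re}] 1) (𝓝 r))
    {σ₀ : ℝ} {H : ℂ → ℂ} (hH : DifferentiableOn ℂ H {s : ℂ | 1 / 2 < s.re})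
    (hHL : ∀ s : ℂ, σ₀ < s.re → H s = partialAsaiL S c A η s) : False := by
  classical
  -- the local factors `e v s = P_v(s) = Q_v(q_v^{-s})`
  set qv : {v : HeightOneSpectrum (𝓞 F) // v ∉ S} → ℕ := fun v => v.1.residueCard with hqv
  set Qv : {v : HeightOneSpectrum (𝓞 F) // v ∉ S} → ℂ[X] := fun v =>
    asaiLocalPolynomial c A η (placeAbove E v.1) with hQv
  set e : {v : HeightOneSpectrum (𝓞 F) // v ∉ S} → ℂ → ℂ := fun v s =>
    (Qv v).eval ((qv v : ℂ) ^ (-s)) with he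
  have hq : ∀ v, 1 < qv v := fun v => v.1.one_lt_residueCard
  have hfin : ∀ X : ℝ, {v : {v : HeightOneSpectrum (𝓞 F) // v ∉ S} | (qv v : ℝ) ≤ X}.Finite :=
    fun X => ((finite_setOf_residueCard_le (K := F) ⌈X⌉₊).preimage
      (Set.injOn_of_injective Subtype.val_injective)).subset fun v hv =>
        Nat.cast_le.mp ((show (qv v : ℝ) ≤ X from hv).trans (Nat.le_ceil X))
  have hed : ∀ v, Differentiable ℂ (e v) := fun v =>
    (Qv v).differentiable.comp (differentiable_id.neg.const_cpow
      (Or.inl (Nat.cast_ne_zero.mpr (zero_lt_one.trans (hq v)).ne')))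
  have hL : ∀ s, partialAsaiL S c A η s = ∏' v, (e v s)⁻¹ := fun s => rfl
  -- (1) near `1⁺`: no factor vanishes and `∑ ‖P_v(s) - 1‖ < ∞`
  obtain ⟨δ, hδ, hnear⟩ : ∃ δ > 0, ∀ s : ℂ, 1 < s.re → dist s 1 < δ →
      (∀ v, e v s ≠ 0) ∧ Summable (fun v => ‖e v s - 1‖) := by
    have h := eventually_summable_norm_sub_one_of_tendsto_partialAsaiL hr hpole
    rw [eventually_nhdsWithin_iff, Metric.eventually_nhds_iff] at h
    obtain ⟨δ, hδ, h⟩ := h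
    exact ⟨δ, hδ, fun s hs hd => ⟨(h hd hs).2.2.1, (h hd hs).2.2.2⟩⟩
  -- (2)–(6) for every `ε > 0`: `L^S = H` at the points near `1⁺` with `Re s > 1 + 2ε`
  have key : ∀ ε : ℝ, 0 < ε → ∀ s : ℂ, 1 + 2 * ε < s.re → dist s 1 < δ →
      partialAsaiL S c A η s = H s := by
    intro ε hε
    -- (2) Baire on `U_ε`
    set U : Set ℂ := {s : ℂ | 1 < s.re ∧ s.re < 1 + ε} ∩ Metric.ball 1 δ with hU
    have hUo : IsOpen U :=
      ((isOpen_lt continuous_const Complex.continuous_re).inter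
        (isOpen_lt Complex.continuous_re continuous_const)).inter Metric.isOpen_ball
    have hUne : U.Nonempty := by
      refine ⟨((1 + min ε δ / 2 : ℝ) : ℂ), ⟨?_, ?_⟩, ?_⟩
      · simp only [Complex.ofReal_re]
        linarith [lt_min hε hδ]
      · simp only [Complex.ofReal_re]
        linarith [min_le_left ε δ]
      · rw [Metric.mem_ball, dist_eq_norm,
          show ((1 + min ε δ / 2 : ℝ) : ℂ) - 1 = ((min ε δ / 2 : ℝ) : ℂ) by push_cast; ring,
          Complex.norm_real, Real.norm_eq_abs, abs_of_pos (by positivity)]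
        linarith [min_le_right ε δ]
    have hUsum : ∀ s ∈ U, Summable fun v => ‖e v s - 1‖ := fun s hs =>
      (hnear s hs.1.1 hs.2).2
    obtain ⟨z, ρ, M, hρ, hzU, hM⟩ := exists_ball_forall_sum_le_of_summable
      (g := fun v s => ‖e v s - 1‖) (fun v => ((hed v).sub_const 1).continuous.norm)
      (fun v s => norm_nonneg _) hUo hUne hUsum
    have hz1 : 1 < z.re := (hzU (Metric.mem_ball_self hρ)).1.1
    have hzε : z.re < 1 + ε := (hzU (Metric.mem_ball_self hρ)).1.2
    -- (3) the summable bound on `{Re z + ε ≤ Re s}`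
    obtain ⟨u, hu0, hu, hule⟩ :=
      exists_summable_norm_sub_one_le_of_forall_sum_le hq hfin Qv hρ hM hε
    -- (4) the bad finite set and the holomorphic, non-vanishing product `G` off it
    have hBfin : {v : {v : HeightOneSpectrum (𝓞 F) // v ∉ S} | ¬ u v < 1 / 2}.Finite :=
      Filter.eventually_cofinite.mp
        (hu.tendsto_cofinite_zero.eventually (gt_mem_nhds (by norm_num : (0 : ℝ) < 1 / 2)))
    set B : Finset {v : HeightOneSpectrum (𝓞 F) // v ∉ S} := hBfin.toFinset with hB
    have hBmem : ∀ v, v ∉ B → u v < 1 / 2 := fun v hv => by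
      by_contra h
      exact hv (hBfin.mem_toFinset.mpr h)
    set e' : {v : HeightOneSpectrum (𝓞 F) // v ∉ S} → ℂ → ℂ := fun v s =>
      if v ∈ B then 1 else e v s with he'
    set u' : {v : HeightOneSpectrum (𝓞 F) // v ∉ S} → ℝ := fun v =>
      if v ∈ B then 0 else u v with hu'def
    have hu' : Summable u' := by
      refine hu.of_nonneg_of_le (fun v => ?_) (fun v => ?_)
      · simp only [hu'def]; split_ifs; exacts [le_rfl, hu0 v]
      · simp only [hu'def]; split_ifs; exacts [hu0 v, le_rfl]
    have hed' : ∀ v, Differentiable ℂ (e' v) := fun v => by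
      by_cases hv : v ∈ B
      · simp only [he', hv, if_true]; exact differentiable_const 1
      · simp only [he', hv, if_false]; exact hed v
    set V : Set ℂ := {s : ℂ | z.re + ε < s.re} with hV
    have hVo : IsOpen V := isOpen_lt continuous_const Complex.continuous_re
    have hle' : ∀ v s, s ∈ V → ‖e' v s - 1‖ ≤ u' v := by
      intro v s hs
      by_cases hv : v ∈ B
      · simp [he', hu'def, hv]
      · simp only [he', hu'def, hv, if_false]
        exact hule v s (le_of_lt hs)
    have hne' : ∀ v s, s ∈ V → e' v s ≠ 0 := by
      intro v s hs
      by_cases hv : v ∈ B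
      · simp [he', hv]
      · simp only [he', hv, if_false]
        intro h0
        have h1 : ‖e v s - 1‖ ≤ u v := hule v s (le_of_lt hs)
        rw [h0, zero_sub, norm_neg, norm_one] at h1
        linarith [hBmem v hv]
    obtain ⟨hGd, hGpt⟩ := differentiableOn_tprod_inv_of_norm_sub_one_le hed' hVo hu' hle' hne'
    set G : ℂ → ℂ := fun s => ∏' v, (e' v s)⁻¹ with hG
    -- factorisation `L^S = (∏_{v ∈ B} P_v⁻¹) · G` on `V`
    have hfact : ∀ s ∈ V, partialAsaiL S c A η s = (∏ v ∈ B, (e v s)⁻¹) * G s := by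
      intro s hs
      have h1 : HasProd (fun v => (e' v s)⁻¹) (G s) := (hGpt s hs).2
      have h2 : HasProd (fun v => if v ∈ B then (e v s)⁻¹ else 1) (∏ v ∈ B, (e v s)⁻¹) := by
        have h : HasProd (fun v => if v ∈ B then (e v s)⁻¹ else 1)
            (∏ v ∈ B, if v ∈ B then (e v s)⁻¹ else 1) :=
          hasProd_prod_of_ne_finset_one fun v hv => if_neg hv
        rwa [Finset.prod_congr rfl (fun v hv => if_pos hv)] at h
      have h3 := h2.mul h1
      have h4 : (fun v => (if v ∈ B then (e v s)⁻¹ else 1) * (e' v s)⁻¹) = fun v => (e v s)⁻¹ := by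
        ext v
        by_cases hv : v ∈ B <;> simp [he', hv]
      rw [h4] at h3
      rw [hL]
      exact h3.tprod_eq
    -- (5) far to the right the bad factors do not vanish; identity theorem on `V`
    obtain ⟨C, hC⟩ : ∃ C : ℝ, ∀ s : ℂ, C ≤ s.re → ∀ v ∈ B, e v s ≠ 0 := by
      have h : ∀ v ∈ B, ∀ᶠ σ : ℝ in atTop, ∀ s : ℂ, σ ≤ s.re → e v s ≠ 0 := fun v _ =>
        eventually_eval_natCast_cpow_neg_ne_zero (hq v)
          (by rw [hQv, eval_zero_asaiLocalPolynomial]; exact one_ne_zero)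
      obtain ⟨C, hC⟩ := ((Filter.eventually_all_finset B).mpr h).exists
      exact ⟨C, fun s hs v hv => hC v hv s hs⟩
    have hVsub : V ⊆ {s : ℂ | 1 / 2 < s.re} := fun s hs => by
      simp only [hV, Set.mem_setOf_eq] at hs ⊢
      linarith
    have hΦd : DifferentiableOn ℂ (fun s => H s * ∏ v ∈ B, e v s) V :=
      (hH.mono hVsub).mul (Differentiable.fun_finsetProd fun v _ => hed v).differentiableOn
    set s₀ : ℂ := ((max (max σ₀ C) (z.re + ε) + 1 : ℝ) : ℂ) with hs₀
    have hs₀V : s₀ ∈ V := by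
      simp only [hV, hs₀, Set.mem_setOf_eq, Complex.ofReal_re]
      linarith [le_max_right (max σ₀ C) (z.re + ε)]
    have hagree : (fun s => H s * ∏ v ∈ B, e v s) =ᶠ[𝓝 s₀] G := by
      have hWo : IsOpen {s : ℂ | max (max σ₀ C) (z.re + ε) < s.re} :=
        isOpen_lt continuous_const Complex.continuous_re
      have hs₀W : s₀ ∈ {s : ℂ | max (max σ₀ C) (z.re + ε) < s.re} := by
        simp only [hs₀, Set.mem_setOf_eq, Complex.ofReal_re]
        linarith
      filter_upwards [hWo.mem_nhds hs₀W] with s hs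
      simp only [max_lt_iff] at hs
      have hsV : s ∈ V := hs.2
      rw [hHL s hs.1.1, hfact s hsV]
      calc (∏ v ∈ B, (e v s)⁻¹) * G s * ∏ v ∈ B, e v s
          = G s * ∏ v ∈ B, ((e v s)⁻¹ * e v s) := by rw [Finset.prod_mul_distrib]; ring
        _ = G s := by
          rw [Finset.prod_eq_one (fun v hv => inv_mul_cancel₀ (hC s hs.1.2.le v hv)), mul_one]
    have hEqOn : Set.EqOn (fun s => H s * ∏ v ∈ B, e v s) G V :=
      (hΦd.analyticOnNhd hVo).eqOn_of_preconnected_of_eventuallyEq (hGd.analyticOnNhd hVo)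
        (convex_halfSpace_re_gt _).isPreconnected hs₀V hagree
    -- (6) near `1⁺` on `V`: `L^S = H`
    intro s hs hsd
    have hsV : s ∈ V := by
      simp only [hV, Set.mem_setOf_eq]
      linarith
    have hne := (hnear s (by linarith) hsd).1
    have hGs : H s * ∏ v ∈ B, e v s = G s := hEqOn hsV
    rw [hfact s hsV, ← hGs]
    calc (∏ v ∈ B, (e v s)⁻¹) * (H s * ∏ v ∈ B, e v s)
        = H s * ∏ v ∈ B, ((e v s)⁻¹ * e v s) := by rw [Finset.prod_mul_distrib]; ring
      _ = H s := by rw [Finset.prod_eq_one (fun v _ => inv_mul_cancel₀ (hne v)), mul_one]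
  -- the limit `L^S(s) → H(1)` contradicts the raw pole
  have hcont : ContinuousAt H 1 :=
    (hH.differentiableAt ((isOpen_lt continuous_const Complex.continuous_re).mem_nhds
      (by simp only [Set.mem_setOf_eq, Complex.one_re]; norm_num))).continuousAt
  have hlim : Tendsto (partialAsaiL S c A η) (𝓝[{s : ℂ | 1 < s.re}] 1) (𝓝 (H 1)) := by
    refine (hcont.tendsto.mono_left nhdsWithin_le_nhds).congr' ?_
    rw [EventuallyEq, eventually_nhdsWithin_iff, Metric.eventually_nhds_iff]
    refine ⟨δ, hδ, fun s hsd hs1 => ?_⟩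
    have hs1' : 1 < s.re := hs1
    exact (key ((s.re - 1) / 3) (by linarith) s (by linarith) hsd).symm
  exact not_tendsto_of_tendsto_sub_one_mul hr hpole (H 1) hlim

end Bridge

section Reps

-- `MatrixGroups`/`Classical` are needed to elaborate `AutomorphyDatum.gl` (as in `AsaiSign.lean`)
open scoped MatrixGroups Classical
open NumberField IsDedekindDomain

variable {F E : Type} [Field F] [NumberField F] [Field E] [NumberField E] [Algebra F E]
  {N : ℕ} {hcpt : isCompact_glFiniteIntegralLevel N E}
  {π : AutomorphicRepData (AutomorphyDatum.gl N E hcpt)} {c : E ≃ₐ[F] E} {η : ℤˣ}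

/-- **A raw Asai pole excludes a holomorphic continuation — unconditionally.** If
`π.HasAsaiPole c η` (for every Asai datum, `(s - 1) L^S(s, Π, As^η) → r ≠ 0` as `s → 1⁺` for the
raw partial Euler product) and `(S, A)` is an Asai datum of `π`, then no function `H` holomorphic on
`{1/2 < Re s}` agrees with `L^S(s, Π, As^η)` on a right half-plane. This is the accepted
`AutomorphicRepData.HasAsaiPole.false_of_holomorphic_continuation`
(`MokStandardBaseChangeDescentContinuation.lean`) with its hypothesis `hhol` (holomorphy of the raw
product on `{1 < Re s}`, "the unpublished ingredient") and `1 ≤ σ₀` removed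
(`false_of_tendsto_partialAsaiL_of_holomorphic_continuation`). With Mok's dichotomy in its
corrected, continuation form (Mok, §2.5 and Thm. 2.5.4 (a); Grbac–Shahidi 2015, Thm. 4.3 (2)) it
pins the sign: a raw pole can only sit at the sign whose continued Asai `L`-function has the pole.
[folklore] -/
theorem AutomorphicRepData.HasAsaiPole.false_of_continuation (hpole : π.HasAsaiPole c η)
    {S : Set (HeightOneSpectrum (𝓞 F))} {A : SatakeFamily E} (hSA : π.IsAsaiDatum c S A)
    {σ₀ : ℝ} {H : ℂ → ℂ} (hH : DifferentiableOn ℂ H {s : ℂ | 1 / 2 < s.re})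
    (hHL : ∀ s : ℂ, σ₀ < s.re → H s = partialAsaiL S c A η s) : False := by
  obtain ⟨r, hr, hrt⟩ := hpole hSA
  exact false_of_tendsto_partialAsaiL_of_holomorphic_continuation hr hrt hH hHL


/-- **`Mok2014_archimedean_parity_of_asaiSign` from its printed-currency form and the corrected Asai
dichotomy** (the analogue, for the archimedean parity fact of `AsaiSign.lean`, of the direction `←`
of the accepted `Mok2014_standardBaseChange_descent_iff_continuation`, here WITHOUT any holomorphy
hypothesis on the raw products, by `AutomorphicRepData.HasAsaiPole.false_of_continuation`).

* `hdich` — verbatim the hypothesis of `Mok2014_partialAsaiL_pole_dichotomy_of_continuation`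
  (`AsaiSignContinuation.lean`) and of `Mok2014_standardBaseChange_descent_iff_continuation`: Mok's
  dichotomy for the meromorphically continued partial Asai `L`-functions of a conjugate self-dual
  cuspidal `Π` (Mok, §2.5, arXiv p. 20: "exactly one of the functions `L(s, φ^N, As^±)` has a pole at
  `s = 1`, which is a simple pole"; Thm. 2.5.4 (a); in full Grbac–Shahidi 2015, Thm. 4.3 (2)).
* `hcont` — the fact `Mok2014_archimedean_parity_of_asaiSign` with its hypothesis `HasAsaiSign c κ`
  (raw pole of `L^S(s, Π, As^{(-1)^{N-1} κ})` at `1⁺` for every Asai datum) replaced by the PRINTED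
  one in the tree's rendering of continued `L`-functions: for every Asai datum the partial
  `As^{(-1)^{N-1} κ}` Euler product is multipliable on some `Re s > σ₀` and `(s - 1) L^S(s)` continues
  to a function `G` holomorphic on `{1/2 < Re s}` with `G(1) ≠ 0` (Mok, Cor. 2.5.5 and its mirror
  image, via Thm. 2.4.10, Lemma 2.2.1, Remark 2.2.2, (2.2.6) — the coset form of the docstring of
  `Mok2014_archimedean_parity_of_asaiSign`). This is what remains to be vendored/proved: Mok's second
  seed theorem 2.4.10 (arXiv p. 16: "the complete proof is achieved only in section nine") and the
  archimedean local Langlands correspondence for `GL_N(ℂ)` behind `HasArchParameter`.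

Proof: given a raw `HasAsaiSign c κ`, the dichotomy sign `η(Π)` must be `(-1)^{N-1} κ` — otherwise
the holomorphic continuation `H` of `L^S(s, Π, As^{(-1)^{N-1} κ})` contradicts the raw pole
(`HasAsaiPole.false_of_continuation`) —, so `hdich` supplies the continued pole that `hcont` wants.
[cite: Mok2014, §2.5, Thm. 2.5.4 (a), Cor. 2.5.5 (arXiv pp. 20–21) and Thm. 2.4.10 (p. 16)] -/
theorem Mok2014_archimedean_parity_of_asaiSign_of_continuation
    (hdich : ∀ (F E : Type) [Field F] [NumberField F] [Field E] [NumberField E] [Algebra F E]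
        (c : E ≃ₐ[F] E), Module.finrank F E = 2 → c ≠ 1 →
        ∀ (N : ℕ) (hcpt : isCompact_glFiniteIntegralLevel N E)
          (π : CuspidalAutomorphicRepData N E hcpt), 0 < N → π.1.IsConjSelfDualAE c →
          ∃ η : ℤˣ, ∀ (S : Set (HeightOneSpectrum (𝓞 F))) (A : SatakeFamily E),
            π.1.IsAsaiDatum c S A →
              ∃ σ₀ : ℝ, 1 ≤ σ₀ ∧
                (∀ (θ : ℤˣ) (s : ℂ), σ₀ < s.re →
                  Multipliable fun v : {v : HeightOneSpectrum (𝓞 F) // v ∉ S} =>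
                    ((asaiLocalPolynomial c A θ (placeAbove E v.1)).eval
                      ((v.1.residueCard : ℂ) ^ (-s)))⁻¹) ∧
                (∃ G : ℂ → ℂ, DifferentiableOn ℂ G {s : ℂ | 1 / 2 < s.re} ∧
                  (∀ s : ℂ, σ₀ < s.re → G s = (s - 1) * partialAsaiL S c A η s) ∧ G 1 ≠ 0) ∧
                (∃ H : ℂ → ℂ, DifferentiableOn ℂ H {s : ℂ | 1 / 2 < s.re} ∧
                  (∀ s : ℂ, σ₀ < s.re → H s = partialAsaiL S c A (-η) s) ∧ H 1 ≠ 0))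
    (hcont : ∀ (F E : Type) [Field F] [NumberField F] [Field E] [NumberField E] [Algebra F E]
        (c : E ≃ₐ[F] E), Module.finrank F E = 2 → c ≠ 1 →
        ∀ (N : ℕ) (hcpt : isCompact_glFiniteIntegralLevel N E)
          (P : CuspidalAutomorphicRepData N E hcpt) (κ : ℤˣ) (χ : (E →+* ℂ) → Multiset ℂ)
          (σ : E →+* ℂ) (r : ℝ), 0 < N → P.1.IsConjSelfDualAE c →
          (∀ (S : Set (HeightOneSpectrum (𝓞 F))) (A : SatakeFamily E), P.1.IsAsaiDatum c S A →
            ∃ σ₀ : ℝ, 1 ≤ σ₀ ∧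
              (∀ s : ℂ, σ₀ < s.re →
                Multipliable fun v : {v : HeightOneSpectrum (𝓞 F) // v ∉ S} =>
                  ((asaiLocalPolynomial c A ((-1) ^ (N + 1) * κ) (placeAbove E v.1)).eval
                    ((v.1.residueCard : ℂ) ^ (-s)))⁻¹) ∧
              ∃ G : ℂ → ℂ, DifferentiableOn ℂ G {s : ℂ | 1 / 2 < s.re} ∧
                (∀ s : ℂ, σ₀ < s.re →
                  G s = (s - 1) * partialAsaiL S c A ((-1) ^ (N + 1) * κ) s) ∧ G 1 ≠ 0) →
          P.1.HasArchParameter χ → NumberField.ComplexEmbedding.IsConj σ c → (χ σ).Nodup →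
          (∀ a ∈ χ σ, ∃ m : ℤ, a = (m : ℂ) + (r : ℂ)) →
          ∀ a ∈ χ σ, ∃ m : ℤ, a = (m : ℂ) + ((N : ℂ) - 1) / 2 + (1 - ((κ : ℤ) : ℂ)) / 4) :
    Mok2014_archimedean_parity_of_asaiSign := by
  intro F E _ _ _ _ _ c h2 hc N hcpt P κ χ σ r hN hcsd hsign hχ hσ hnd hcoset
  refine hcont F E c h2 hc N hcpt P κ χ σ r hN hcsd (fun S A hSA => ?_) hχ hσ hnd hcoset
  obtain ⟨η₀, hη₀⟩ := hdich F E c h2 hc N hcpt P hN hcsd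
  obtain ⟨σ₀, hσ₀, hmult, ⟨G, hG, hGL, hG1⟩, ⟨H, hH, hHL, -⟩⟩ := hη₀ S A hSA
  -- the raw pole given by `HasAsaiSign c κ = HasAsaiPole c ((-1)^(N+1) κ)`
  have hpole : P.1.HasAsaiPole c ((-1) ^ (N + 1) * κ) := hsign
  set θ : ℤˣ := (-1) ^ (N + 1) * κ with hθ
  clear_value θ
  by_cases hηθ : η₀ = θ
  · subst hηθ
    exact ⟨σ₀, hσ₀, fun s hs => hmult _ s hs, G, hG, hGL, hG1⟩
  · have hneg : -η₀ = θ := by rw [Int.units_ne_iff_eq_neg.mp hηθ, neg_neg]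
    exact (hpole.false_of_continuation hSA hH (fun s hs => by rw [hHL s hs, hneg])).elim

end Reps

/-! ### The positive form of the bridge: a raw pole at `1` forces absolute convergence on `{1 < Re s}` -/

section RawPoleConvergence

open NumberField IsDedekindDomain Polynomial

variable {F E : Type} [Field F] [NumberField F] [Field E] [Algebra F E]

/-- **A raw pole at `s = 1` forces normal convergence of the partial Asai Euler product on every
closed half-plane `{σ₁ ≤ Re s}`, `σ₁ > 1`.** If `(s - 1) · L^S(s, A, As^η) → r ≠ 0` as `s → 1⁺`
for the unconditional `tprod` `L^S = partialAsaiL S c A η`, then for every `σ₁ > 1` there is a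
summable `u ≥ 0` with `‖P_v(s) - 1‖ ≤ u_v` for all `v ∉ S` and all `s` with `Re s ≥ σ₁`
(`P_v(s) = (asaiLocalPolynomial c A η w_v)(q_v^{-s})`). Steps (1)–(3) of
`false_of_tendsto_partialAsaiL_of_holomorphic_continuation` with `ε = (σ₁ - 1)/2`: absolute
convergence near `1⁺` (`eventually_summable_norm_sub_one_of_tendsto_partialAsaiL`), Baire on
`{1 < Re s < 1 + ε} ∩ B(1, δ)` (`exists_ball_forall_sum_le_of_summable`), and the Cauchy-estimate
propagation to `{Re z + ε ≤ Re s} ⊇ {σ₁ ≤ Re s}` (`exists_summable_norm_sub_one_le_of_forall_sum_le`).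
So the raw-limit pole of `AutomorphicRepData.HasAsaiPole` carries exactly the absolute convergence
on `{1 < Re s}` that is "not in print for `N ≥ 3`" for the Asai Euler product of a general conjugate
self-dual cuspidal `Π` (module docstring of `AsaiSign.lean`, "Complete versus partial").
[folklore] -/
theorem exists_summable_norm_sub_one_le_of_tendsto_partialAsaiL
    {S : Set (HeightOneSpectrum (𝓞 F))} {c : E ≃ₐ[F] E} {A : SatakeFamily E} {η : ℤˣ} {r : ℂ}
    (hr : r ≠ 0)
    (hpole : Tendsto (fun s => (s - 1) * partialAsaiL S c A η s) (𝓝[{s : ℂ | 1 < s.re}] 1) (𝓝 r))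
    {σ₁ : ℝ} (hσ₁ : 1 < σ₁) :
    ∃ u : {v : HeightOneSpectrum (𝓞 F) // v ∉ S} → ℝ, (∀ v, 0 ≤ u v) ∧ Summable u ∧
      ∀ (v : {v : HeightOneSpectrum (𝓞 F) // v ∉ S}) (s : ℂ), σ₁ ≤ s.re →
        ‖(asaiLocalPolynomial c A η (placeAbove E v.1)).eval ((v.1.residueCard : ℂ) ^ (-s)) - 1‖ ≤
          u v := by
  classical
  set qv : {v : HeightOneSpectrum (𝓞 F) // v ∉ S} → ℕ := fun v => v.1.residueCard with hqv
  set Qv : {v : HeightOneSpectrum (𝓞 F) // v ∉ S} → ℂ[X] := fun v =>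
    asaiLocalPolynomial c A η (placeAbove E v.1) with hQv
  set e : {v : HeightOneSpectrum (𝓞 F) // v ∉ S} → ℂ → ℂ := fun v s =>
    (Qv v).eval ((qv v : ℂ) ^ (-s)) with he
  have hq : ∀ v, 1 < qv v := fun v => v.1.one_lt_residueCard
  have hfin : ∀ X : ℝ, {v : {v : HeightOneSpectrum (𝓞 F) // v ∉ S} | (qv v : ℝ) ≤ X}.Finite :=
    fun X => ((finite_setOf_residueCard_le (K := F) ⌈X⌉₊).preimage
      (Set.injOn_of_injective Subtype.val_injective)).subset fun v hv =>
        Nat.cast_le.mp ((show (qv v : ℝ) ≤ X from hv).trans (Nat.le_ceil X))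
  have hed : ∀ v, Differentiable ℂ (e v) := fun v =>
    (Qv v).differentiable.comp (differentiable_id.neg.const_cpow
      (Or.inl (Nat.cast_ne_zero.mpr (zero_lt_one.trans (hq v)).ne')))
  -- (1) near `1⁺`: `∑ ‖P_v(s) - 1‖ < ∞`
  obtain ⟨δ, hδ, hnear⟩ : ∃ δ > 0, ∀ s : ℂ, 1 < s.re → dist s 1 < δ →
      Summable (fun v => ‖e v s - 1‖) := by
    have h := eventually_summable_norm_sub_one_of_tendsto_partialAsaiL hr hpole
    rw [eventually_nhdsWithin_iff, Metric.eventually_nhds_iff] at h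
    obtain ⟨δ, hδ, h⟩ := h
    exact ⟨δ, hδ, fun s hs hd => (h hd hs).2.2.2⟩
  -- (2) Baire on `U_ε`, `ε = (σ₁ - 1)/2`
  set ε : ℝ := (σ₁ - 1) / 2 with hεdef
  have hε : 0 < ε := by rw [hεdef]; linarith
  set U : Set ℂ := {s : ℂ | 1 < s.re ∧ s.re < 1 + ε} ∩ Metric.ball 1 δ with hU
  have hUo : IsOpen U :=
    ((isOpen_lt continuous_const Complex.continuous_re).inter
      (isOpen_lt Complex.continuous_re continuous_const)).inter Metric.isOpen_ball
  have hUne : U.Nonempty := by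
    refine ⟨((1 + min ε δ / 2 : ℝ) : ℂ), ⟨?_, ?_⟩, ?_⟩
    · simp only [Complex.ofReal_re]
      linarith [lt_min hε hδ]
    · simp only [Complex.ofReal_re]
      linarith [min_le_left ε δ]
    · rw [Metric.mem_ball, dist_eq_norm,
        show ((1 + min ε δ / 2 : ℝ) : ℂ) - 1 = ((min ε δ / 2 : ℝ) : ℂ) by push_cast; ring,
        Complex.norm_real, Real.norm_eq_abs, abs_of_pos (by positivity)]
      linarith [min_le_right ε δ]
  have hUsum : ∀ s ∈ U, Summable fun v => ‖e v s - 1‖ := fun s hs => hnear s hs.1.1 hs.2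
  obtain ⟨z, ρ, M, hρ, hzU, hM⟩ := exists_ball_forall_sum_le_of_summable
    (g := fun v s => ‖e v s - 1‖) (fun v => ((hed v).sub_const 1).continuous.norm)
    (fun v s => norm_nonneg _) hUo hUne hUsum
  have hzε : z.re < 1 + ε := (hzU (Metric.mem_ball_self hρ)).1.2
  -- (3) the summable bound on `{Re z + ε ≤ Re s} ⊇ {σ₁ ≤ Re s}`
  obtain ⟨u, hu0, hu, hule⟩ :=
    exists_summable_norm_sub_one_le_of_forall_sum_le hq hfin Qv hρ hM hε
  refine ⟨u, hu0, hu, fun v s hs => hule v s ?_⟩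
  have : z.re + ε < σ₁ := by rw [hεdef] at hzε ⊢; linarith
  linarith

/-- **A raw pole at `s = 1` forces absolute convergence of the partial Asai Euler product at every
point of `{1 < Re s}`**: `∑_{v ∉ S} ‖P_v(s) - 1‖ < ∞` (and therefore the product over all but the
finitely many `v` with `‖P_v(s) - 1‖ ≥ 1` converges absolutely to a non-zero value).
[folklore] -/
theorem summable_norm_sub_one_of_tendsto_partialAsaiL
    {S : Set (HeightOneSpectrum (𝓞 F))} {c : E ≃ₐ[F] E} {A : SatakeFamily E} {η : ℤˣ} {r : ℂ}
    (hr : r ≠ 0)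
    (hpole : Tendsto (fun s => (s - 1) * partialAsaiL S c A η s) (𝓝[{s : ℂ | 1 < s.re}] 1) (𝓝 r))
    {s : ℂ} (hs : 1 < s.re) :
    Summable fun v : {v : HeightOneSpectrum (𝓞 F) // v ∉ S} =>
      ‖(asaiLocalPolynomial c A η (placeAbove E v.1)).eval ((v.1.residueCard : ℂ) ^ (-s)) - 1‖ := by
  obtain ⟨u, -, hu, hle⟩ := exists_summable_norm_sub_one_le_of_tendsto_partialAsaiL hr hpole
    (σ₁ := (1 + s.re) / 2) (by linarith)
  exact hu.of_nonneg_of_le (fun v => norm_nonneg _) (fun v => hle v s (by linarith))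

end RawPoleConvergence

section RepsConvergence

-- `MatrixGroups`/`Classical` are needed to elaborate `AutomorphyDatum.gl` (as in `AsaiSign.lean`)
open scoped MatrixGroups Classical
open NumberField IsDedekindDomain Polynomial

variable {F E : Type} [Field F] [NumberField F] [Field E] [NumberField E] [Algebra F E]
  {N : ℕ} {hcpt : isCompact_glFiniteIntegralLevel N E}
  {π : AutomorphicRepData (AutomorphyDatum.gl N E hcpt)} {c : E ≃ₐ[F] E} {η : ℤˣ}

/-- **`HasAsaiPole` entails absolute convergence on `{1 < Re s}`.** If `π.HasAsaiPole c η` and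
`(S, A)` is an Asai datum of `π`, the partial Asai Euler product of `A` satisfies
`∑_{v ∉ S} ‖P_v(s) - 1‖ < ∞` at every `s` with `Re s > 1`
(`summable_norm_sub_one_of_tendsto_partialAsaiL`). [folklore] -/
theorem AutomorphicRepData.HasAsaiPole.summable_norm_sub_one (hpole : π.HasAsaiPole c η)
    {S : Set (HeightOneSpectrum (𝓞 F))} {A : SatakeFamily E} (hSA : π.IsAsaiDatum c S A)
    {s : ℂ} (hs : 1 < s.re) :
    Summable fun v : {v : HeightOneSpectrum (𝓞 F) // v ∉ S} =>
      ‖(asaiLocalPolynomial c A η (placeAbove E v.1)).eval ((v.1.residueCard : ℂ) ^ (-s)) - 1‖ := by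
  obtain ⟨r, hr, hrt⟩ := hpole hSA
  exact summable_norm_sub_one_of_tendsto_partialAsaiL hr hrt hs

end RepsConvergence

end Literature.NumberTheory.Automorphic
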